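import Summits.ResolutionOfSingularities.ResolutionOfSingularities.Theorems.FrobeniusLadderFInjectiveMacaulayficationFHalfRowOfTwoStoreys
import Literature.AlgebraicGeometry.Resolution.ProOpenIdealExtension
import Literature.AlgebraicGeometry.Resolution.BlowupsExistence
import HarnessLib

/-!
# (W-TD) TWO-STOREY GLUE, LOCAL SECOND STOREY: the storey-2 centre given on `Spec 𝒪_{X₁,P}` only (Temkin 2.1.1 extends it), FULL-ness given at the germ of `P`
# (crux `FInjectiveMacaulayfication` stmt-ResolutionOfSingularities-15315, chain w45a; res-L1-w45a-plan-1 R21.15 (2)(D-3) / R21.16 «stub-1: FD two-storey row assembly»; seat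
# res-L1-w45a-stub-1 g12; sequel of ✓ p658557 `FHalfRowOfTwoStoreys` + ✓ p664098 `GermFullOfModel`; the design of STATUS 20:08Z/20:13Z made rigorous by the tree's
# Temkin 2008 Lemma 2.1.1 `Literature…exists_idealSheaf_extension_fromSpecStalk`)

[OURS · L1 W4.5a] Support file (`--supports stmt-ResolutionOfSingularities-15315 --as helper`); def-free; UNCONDITIONAL; no named fact; NOT a statement of any manuscript.
AI-written (AI review is weaker than expert review).

WHY. The CI chart engine identifies the chart of `X₁ = Bl_{𝔪·K} X` through the storey-2 point `P` with `Spec k[Y]/(G)` only LOCALLY (`𝒪_{X₁,P} ≅ (k[Y]/(G))_{Q'}`), so the storey-2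
cure of BED D is naturally a datum on `Spec 𝒪_{X₁,P}`: an ideal sheaf `𝔍 ≠ ⊥` supported at the closed point ALL of whose blowings up are FULL (the class row ✓ p656605 transported by
✓ p664098). ★★ `fHalfConclusion_of_localSecondStorey` turns exactly this LOCAL datum + «`X₁` FULL at every other point over a generization of `x`» (D-1) into the F-half's conclusion
for the input floor: extend `𝔍` to an ideal sheaf `J′` on `X₁` with `J′·𝒪_{Spec 𝒪_{X₁,P}} = 𝔍` and `Supp J′ ⊆ {P}` (Temkin 2.1.1 for `Spec 𝒪_{X₁,P} = X₁ ×_{X₁} Spec 𝒪_{X₁,P}`),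
blow `X₁` up along `J′` (`exists_isBlowup`), check FULL-ness over the generizations of `x` (over `P`: flat base change to `Spec 𝒪_{X₁,P}` + `hfull₂` + stalk isomorphisms; elsewhere
`π₂` is a local isomorphism and `X₁` is FULL there), and feed ✓ p658557 `fHalfConclusion_of_twoStoreys`.
[cite: Temkin2008, Lemma 2.1.1 and Lemma 2.1.4] [cite: StacksProject, Tag 080B and Tag 01J7] [cite: GortzWedhorn2020, Prop. 13.91]
-/

-- single-problem summit: the doubled namespace component is forced
set_option linter.dupNamespace false

noncomputable section

namespace Summit.ResolutionOfSingularities.ResolutionOfSingularities.Theorems.FInjectiveMacaulayfication.FHalfRowOfTwoStoreys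

open CategoryTheory CategoryTheory.Limits AlgebraicGeometry TopologicalSpace IsLocalRing
open Literature.AlgebraicGeometry.Resolution
open Summit.ResolutionOfSingularities.ResolutionOfSingularities.Theorems.FInjectiveMacaulayfication
open SliceableCentre GermOfGlobalBlowup

/-- Pull-back of ideal sheaves along an isomorphism is injective. [plumbing] -/
theorem comap_injective_of_isIso {S T : Scheme.{0}} (e : S ⟶ T) [IsIso e] {I J : T.IdealSheafData} (h : I.comap e = J.comap e) : I = J := by
  have h1 : ∀ K : T.IdealSheafData, (K.comap e).comap (inv e) = K := fun K => by
    rw [← Scheme.IdealSheafData.comap_comp, IsIso.inv_hom_id, Scheme.IdealSheafData.comap_id]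
  rw [← h1 I, ← h1 J, h]

/-- ★★ **TWO-STOREY GLUE WITH A LOCAL SECOND STOREY.** See the module docstring. `X` integral Noetherian, `x ∈ X`; STOREY 1: a blowing up `π₁ : X₁ → X` along `Jτ·JK ≠ ⊥` with
supports meeting the generizations of `x` only in `x`; a CLOSED point `P ∈ X₁` over `x`; STOREY 2, LOCALLY AT `P`: an ideal sheaf `𝔍 ≠ ⊥` on `Spec 𝒪_{X₁,P}` supported at the closed
point such that EVERY blowing up of `Spec 𝒪_{X₁,P}` along `𝔍` is FULL at every stalk; and `X₁` FULL at every point `≠ P` lying over a generization of `x`. THEN the F-half's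
conclusion holds for every blowing up of `Spec 𝒪_{X,x}` along `Jτ·𝒪_{X,x}`. [cite: Temkin2008, Lemma 2.1.1 and Lemma 2.1.4] [cite: StacksProject, Tag 080B] -/
theorem fHalfConclusion_of_localSecondStorey (p : ℕ) {X X₁ : Scheme.{0}} [IsIntegral X] [IsNoetherian X] (x : X)
    {π₁ : X₁ ⟶ X} {Jτ JK : X.IdealSheafData} (hπ₁ : IsBlowup π₁ (Jτ * JK)) (hJ : Jτ * JK ≠ ⊥)
    (hsuppτ : ∀ y ∈ (Jτ.support : Set X), y ⤳ x → y = x) (hsuppK : ∀ y ∈ (JK.support : Set X), y ⤳ x → y = x)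
    (P : X₁) (hPx : π₁.base P = x) (hP : IsClosed ({P} : Set X₁))
    (𝔍 : (Spec (X₁.presheaf.stalk P)).IdealSheafData) (h𝔍 : 𝔍 ≠ ⊥)
    (h𝔍supp : ∀ s ∈ (𝔍.support : Set (Spec (X₁.presheaf.stalk P))), s = closedPoint (X₁.presheaf.stalk P))
    (hfull₂ : ∀ (S'' : Scheme.{0}) (g : S'' ⟶ Spec (X₁.presheaf.stalk P)), IsBlowup g 𝔍 → ∀ s : S'', FullCl p (S''.presheaf.stalk s))
    (hfull₁ : ∀ x₁ : X₁, x₁ ≠ P → π₁.base x₁ ⤳ x → FullCl p (X₁.presheaf.stalk x₁)) :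
    ∀ (S' : Scheme.{0}) (g : S' ⟶ Spec (X.presheaf.stalk x)), IsBlowup g (Jτ.comap (X.fromSpecStalk x)) →
      ∃ 𝓚 : S'.IdealSheafData, 𝓚 ≠ ⊥ ∧ (∀ s ∈ (𝓚.support : Set S'), g.base s = closedPoint (X.presheaf.stalk x)) ∧
        ∀ (S'' : Scheme.{0}) (π : S'' ⟶ S'), IsBlowup π 𝓚 → ∀ s : S'', FullCl p (S''.presheaf.stalk s) := by
  haveI : IsProper π₁ := hπ₁.isProper
  haveI : IsLocallyNoetherian X₁ := LocallyOfFiniteType.isLocallyNoetherian π₁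
  -- Temkin 2.1.1 for `S := X₁ ×_{X₁} Spec 𝒪_{X₁,P} ≅ Spec 𝒪_{X₁,P}`
  set m := X₁.fromSpecStalk P with hm
  set e := pullback.snd (𝟙 X₁) m with he
  have hje : pullback.fst (𝟙 X₁) m = e ≫ m := by
    have := pullback.condition (f := 𝟙 X₁) (g := m)
    rw [Category.comp_id] at this
    exact this
  obtain ⟨J', hJ'comap, hJ'supp⟩ := exists_idealSheaf_extension_fromSpecStalk (𝟙 X₁) P (𝔍.comap e)
  -- `J′·𝒪_{Spec 𝒪_{X₁,P}} = 𝔍`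
  have hJ'm : J'.comap m = 𝔍 := by
    apply comap_injective_of_isIso e
    rw [← Scheme.IdealSheafData.comap_comp, ← hje, hJ'comap]
  -- `J′ ≠ ⊥`
  have hJ'ne : J' ≠ ⊥ := by
    intro h0
    apply h𝔍
    rw [← hJ'm, h0, Scheme.IdealSheafData.comap_bot]
  -- `Supp J′ ⊆ {P}`
  have hJ'P : ∀ y₁ ∈ (J'.support : Set X₁), y₁ = P := by
    intro y₁ hy₁
    rw [hJ'supp] at hy₁
    have hsub : pullback.fst (𝟙 X₁) m '' ((𝔍.comap e).support : Set _) ⊆ {P} := by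
      rintro _ ⟨t, ht, rfl⟩
      rw [Scheme.IdealSheafData.support_comap] at ht
      have ht' : e t ∈ (𝔍.support : Set _) := ht
      have h1 : e t = closedPoint (X₁.presheaf.stalk P) := h𝔍supp _ ht'
      show (pullback.fst (𝟙 X₁) m) t ∈ ({P} : Set X₁)
      rw [hje, Scheme.Hom.comp_apply, h1, hm, Scheme.fromSpecStalk_closedPoint]
      exact Set.mem_singleton P
    exact Set.mem_singleton_iff.mp ((closure_minimal hsub hP) hy₁)
  -- STOREY 2 globally: blow `X₁` up along `J′`
  obtain ⟨X₂, π₂, hπ₂⟩ := exists_isBlowup X₁ J'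
  have hsupp' : ∀ y₁ ∈ (J'.support : Set X₁), π₁.base y₁ ⤳ x → π₁.base y₁ = x := fun y₁ hy₁ _ => by rw [hJ'P y₁ hy₁, hPx]
  -- FULL-ness of `X₂` over the generizations of `x`
  have hfull : ∀ x₂ : X₂, (π₂ ≫ π₁).base x₂ ⤳ x → FullCl p (X₂.presheaf.stalk x₂) := by
    intro x₂ hx₂
    by_cases hgen : x₂ ∈ Set.range (pullback.fst π₂ m)
    · -- over the generizations of `P`: the flat pull-back to `Spec 𝒪_{X₁,P}` is a blowing up along `𝔍`, FULL by `hfull₂`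
      obtain ⟨t, rfl⟩ := hgen
      haveI : Flat m := flat_fromSpecStalk X₁ P
      have hB : IsBlowup (pullback.snd π₂ m) (J'.comap m) := hπ₂.pullback_snd_of_flat m
      rw [hJ'm] at hB
      haveI := isIso_stalkMap_pullback_fst_fromSpecStalk π₂ P t
      exact FTemkinClosedPoints.fullCl_of_isIso_stalkMap p (pullback.fst π₂ m) t (hfull₂ _ _ hB t)
    · -- elsewhere `π₂` is a local isomorphism and `X₁` is FULL
      have hnot : ¬ π₂.base x₂ ⤳ P := by
        intro hsp
        apply hgen
        rw [range_pullback_fst_fromSpecStalk]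
        exact hsp
      have hne : π₂.base x₂ ≠ P := fun h => hnot (h ▸ specializes_rfl)
      have hU : π₂.base x₂ ∈ (⟨(J'.support : Set X₁)ᶜ, J'.support.isClosed.isOpen_compl⟩ : X₁.Opens) := fun h => hne (hJ'P _ h)
      haveI : IsIso (π₂ ∣_ (⟨(J'.support : Set X₁)ᶜ, J'.support.isClosed.isOpen_compl⟩ : X₁.Opens)) := hπ₂.isIso_compl
      haveI := isIso_stalkMap_of_isIso_morphismRestrict π₂ _ x₂ hU
      refine FTemkinClosedPoints.fullCl_of_isIso_stalkMap' p π₂ x₂ (hfull₁ _ hne ?_)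
      have : (π₂ ≫ π₁).base x₂ = π₁.base (π₂.base x₂) := by rw [Scheme.Hom.comp_base]; rfl
      rw [this] at hx₂
      exact hx₂
  exact fHalfConclusion_of_twoStoreys p x hπ₁ hJ hsuppτ hsuppK hπ₂ hJ'ne hsupp' hfull

end Summit.ResolutionOfSingularities.ResolutionOfSingularities.Theorems.FInjectiveMacaulayfication.FHalfRowOfTwoStoreys

end
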